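import Summits.AtomisticToContinuum.FouriersLaw.Theorems.LocalOhmBVLocalOhmCurrentVsRegularity
import Summits.AtomisticToContinuum.FouriersLaw.Theorems.ParityLiouvilleSeedWindowLimitLiouvilleBounds

/-!
# Window-function bookkeeping for T♯4 `stub_noUnitCurrent_of_zeroDrudeVar` (helpers, 1/1)
(crux `LocalOhmBV.LocalOhm`, item stmt-AtomisticToContinuum-12009, line `registered`/birth, skeleton v9; the
bridge itself is `LocalOhmBVLocalOhmStubNoUnitCurrentOfZeroDrudeVar.lean`)

The bridge T♯4 evaluates a functional `Λ`, linear on continuous polynomially bounded cylinder pairs ON ONE BOX,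
on block sums `Σ_{x≤M} (j_x − 𝒜(G ∘ box_{a+x,n}) − E ∘ box_{a+x,n})` of the infinite pinned chain
`P = pinnedChain ω₂ lam β γ`. This file supplies the cylinder bookkeeping:

* `exists_subwindow_proj`, `exists_bigWindow` — a continuous polynomially bounded window function on a box
  `{a', …, a'+n'} ⊆ {A₀, …, A₀+K}` is one on the big box, with the same polynomial bound;
* `exists_liouvilleWindow` — the Liouville derivative `𝒜(G ∘ box_{a,n})` of a `C¹` cylinder function with
  polynomially bounded derivative is a continuous polynomially bounded window function on `{a-1, …, a+n+1}`
  (box formula `liouvilleZ_comp_boxRestrictAt`, closed form `WindowLimit.pinnedChain_force_eq` and cubic bound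
  of the force), uniformly in the position `a`;
* `exists_bondCurrentWindow` — the bond current `j_x` as a window function on `{x, x+1}`;
* `apply_lin3_comp_boxRestrictAt`, `blockWindow_spec` — three-term linearity and the value of `Λ` on block
  windows `Σ_i (c₁ J_i + c₂ L_i + c₃ E_i)` with `Λ(J_i ∘ box) = 1`, `Λ(L_i ∘ box) = 0`.

No definitions.
-/

set_option autoImplicit false

noncomputable section

namespace Summit.AtomisticToContinuum.FouriersLaw.Theorems.LocalOhmBirth

open MeasureTheory Filter Topology
open scoped BigOperators
open Literature.MathematicalPhysics.KineticTheory
open Literature.MathematicalPhysics.KineticTheory.HeatConduction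

/-! ## Sub-windows of a box -/

/-- **Sub-windows.** A box `{a', …, a'+n'}` contained in `{A₀, …, A₀+K}` is read inside the big box by a
coordinate projection `π` (continuous, norm non-increasing) with `π ∘ box_{A₀,K} = box_{a',n'}`. -/
theorem exists_subwindow_proj {A₀ a' : ℤ} {K n' : ℕ} (h₁ : A₀ ≤ a') (h₂ : a' + n' ≤ A₀ + K) :
    ∃ π : (Fin (K + 1) → ℝ × ℝ) → (Fin (n' + 1) → ℝ × ℝ), Continuous π ∧ (∀ y, ‖π y‖ ≤ ‖y‖) ∧
      ∀ σ : ChainConfig, π (boxRestrictAt A₀ K σ) = boxRestrictAt a' n' σ := by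
  let idx : Fin (n' + 1) → Fin (K + 1) := fun i => ⟨(a' - A₀ + i).toNat, by have := i.isLt; omega⟩
  have hidx : ∀ i : Fin (n' + 1), A₀ + ((idx i : ℕ) : ℤ) = a' + i := by
    intro i
    have := i.isLt
    simp only [idx]
    omega
  refine ⟨fun y i => y (idx i), continuous_pi fun i => continuous_apply _,
    fun y => (pi_norm_le_iff_of_nonneg (norm_nonneg y)).2 fun i => norm_le_pi_norm y _, fun σ => ?_⟩
  funext i
  simp only [boxRestrictAt_apply, hidx]

/-! ## The Liouville derivative of a `C¹` cylinder function as a window function -/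

/-- The closed-form force of the pinned chain, as a function of the three positions `a, b, c` at the
sites `z-1, z, z+1`, is cubically bounded (the estimate `WindowLimit.pinnedChain_abs_force_le` read on
window coordinates). -/
theorem abs_forceExpr_le (ω₂ lam β a b c : ℝ) :
    |-(ω₂ * b + lam * b ^ 3) + (((c - b) + β * (c - b) ^ 3)) - (((b - a) + β * (b - a) ^ 3))| ≤
      (|ω₂| + |lam| + 4 + 8 * |β|) * (1 + (|a| ^ 3 + |b| ^ 3 + |c| ^ 3)) := by
  -- adapted from `WindowLimit.pinnedChain_abs_force_le`
  have hb := WindowLimit.abs_le_one_add_abs_pow_three b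
  have hU : |-(ω₂ * b + lam * b ^ 3)| ≤ (|ω₂| + |lam|) * (1 + |b| ^ 3) := by
    rw [abs_neg]
    calc |ω₂ * b + lam * b ^ 3| ≤ |ω₂| * |b| + |lam| * |b| ^ 3 := by
          refine (abs_add_le _ _).trans ?_; rw [abs_mul, abs_mul, abs_pow]
      _ ≤ |ω₂| * (1 + |b| ^ 3) + |lam| * (1 + |b| ^ 3) := by
          refine add_le_add (mul_le_mul_of_nonneg_left hb (abs_nonneg _))
            (mul_le_mul_of_nonneg_left ?_ (abs_nonneg _))
          linarith [pow_nonneg (abs_nonneg b) 3]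
      _ = (|ω₂| + |lam|) * (1 + |b| ^ 3) := by ring
  have h1 := WindowLimit.abs_sub_add_mul_pow_le β c b
  have h2 := WindowLimit.abs_sub_add_mul_pow_le β b a
  have h3a := pow_nonneg (abs_nonneg a) 3
  have h3b := pow_nonneg (abs_nonneg b) 3
  have h3c := pow_nonneg (abs_nonneg c) 3
  calc _ ≤ |-(ω₂ * b + lam * b ^ 3) + (c - b + β * (c - b) ^ 3)| + |b - a + β * (b - a) ^ 3| := abs_sub _ _
    _ ≤ |-(ω₂ * b + lam * b ^ 3)| + |c - b + β * (c - b) ^ 3| + |b - a + β * (b - a) ^ 3| :=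
        add_le_add (abs_add_le _ _) le_rfl
    _ ≤ (|ω₂| + |lam|) * (1 + |b| ^ 3) + (2 + 4 * |β|) * (1 + |c| ^ 3 + |b| ^ 3) +
          (2 + 4 * |β|) * (1 + |b| ^ 3 + |a| ^ 3) := add_le_add (add_le_add hU h1) h2
    _ ≤ (|ω₂| + |lam| + 4 + 8 * |β|) * (1 + (|a| ^ 3 + |b| ^ 3 + |c| ^ 3)) := by
        nlinarith [abs_nonneg ω₂, abs_nonneg lam, abs_nonneg β, mul_nonneg (abs_nonneg β) h3a,
          mul_nonneg (abs_nonneg β) h3b, mul_nonneg (abs_nonneg β) h3c, mul_nonneg (abs_nonneg ω₂) h3a,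
          mul_nonneg (abs_nonneg ω₂) h3c, mul_nonneg (abs_nonneg lam) h3a, mul_nonneg (abs_nonneg lam) h3c]

/-- **The Liouville derivative `𝒜(G ∘ box_{a,n})` of a `C¹` cylinder function of the pinned chain is a
continuous polynomially bounded window function on the box `{a-1, …, a+n+1}`**, with a window function and a
polynomial bound not depending on the position `a` of the box (box formula `liouvilleZ_comp_boxRestrictAt`,
closed form and cubic bound of the force). -/
theorem exists_liouvilleWindow :
    ∀ (ω₂ lam β γ : ℝ) (n : ℕ) (G : (Fin (n + 1) → ℝ × ℝ) → ℝ), ContDiff ℝ 1 G →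
    ∀ (C₀ : ℝ) (m : ℕ), (∀ y, ‖fderiv ℝ G y‖ ≤ C₀ * (1 + ‖y‖) ^ m) →
    ∃ gL : (Fin (n + 2 + 1) → ℝ × ℝ) → ℝ, Continuous gL ∧
      (∀ y, |gL y| ≤
        ((n : ℝ) + 1) * (C₀ * (1 + 3 * (|ω₂| + |lam| + 4 + 8 * |β|))) * (1 + ‖y‖) ^ (m + 3)) ∧
      ∀ a : ℤ, gL ∘ boxRestrictAt (a - 1) (n + 2) =
        liouvilleZ (pinnedChain ω₂ lam β γ) (G ∘ boxRestrictAt a n) := by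
  intro ω₂ lam β γ n G hG C₀ m hd
  -- window coordinates: site `a + i` of the small box is coordinate `i + 1` of the big box
  let i0 : Fin (n + 1) → Fin (n + 2 + 1) := fun i => ⟨(i : ℕ), by omega⟩
  let i1 : Fin (n + 1) → Fin (n + 2 + 1) := fun i => ⟨(i : ℕ) + 1, by omega⟩
  let i2 : Fin (n + 1) → Fin (n + 2 + 1) := fun i => ⟨(i : ℕ) + 2, by omega⟩
  let π : (Fin (n + 2 + 1) → ℝ × ℝ) → (Fin (n + 1) → ℝ × ℝ) := fun y i => y (i1 i)
  let Fw : (Fin (n + 2 + 1) → ℝ × ℝ) → Fin (n + 1) → ℝ := fun y i =>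
    -(ω₂ * (y (i1 i)).1 + lam * (y (i1 i)).1 ^ 3) +
      (((y (i2 i)).1 - (y (i1 i)).1) + β * ((y (i2 i)).1 - (y (i1 i)).1) ^ 3) -
        (((y (i1 i)).1 - (y (i0 i)).1) + β * ((y (i1 i)).1 - (y (i0 i)).1) ^ 3)
  let gL : (Fin (n + 2 + 1) → ℝ × ℝ) → ℝ := fun y => ∑ i : Fin (n + 1),
    ((y (i1 i)).2 * fderiv ℝ G (π y) (Pi.single i (1, 0)) + Fw y i * fderiv ℝ G (π y) (Pi.single i (0, 1)))
  have hπc : Continuous π := continuous_pi fun i => continuous_apply _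
  have hπn : ∀ y, ‖π y‖ ≤ ‖y‖ := fun y =>
    (pi_norm_le_iff_of_nonneg (norm_nonneg y)).2 fun i => norm_le_pi_norm y _
  have e0 : ∀ (a : ℤ) (i : Fin (n + 1)), a - 1 + ((i0 i : ℕ) : ℤ) = a + i - 1 := by
    intro a i; simp only [i0]; ring
  have e1 : ∀ (a : ℤ) (i : Fin (n + 1)), a - 1 + ((i1 i : ℕ) : ℤ) = a + i := by
    intro a i; simp only [i1]; push_cast; ring
  have e2 : ∀ (a : ℤ) (i : Fin (n + 1)), a - 1 + ((i2 i : ℕ) : ℤ) = a + i + 1 := by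
    intro a i; simp only [i2]; push_cast; ring
  have hπbox : ∀ (a : ℤ) (σ : ChainConfig), π (boxRestrictAt (a - 1) (n + 2) σ) = boxRestrictAt a n σ := by
    intro a σ
    funext i
    simp only [π, boxRestrictAt_apply, e1]
  have hFw : ∀ (a : ℤ) (σ : ChainConfig) (i : Fin (n + 1)),
      Fw (boxRestrictAt (a - 1) (n + 2) σ) i = (pinnedChain ω₂ lam β γ).force σ (a + i) := by
    intro a σ i
    rw [WindowLimit.pinnedChain_force_eq]
    simp only [Fw, boxRestrictAt_apply, e0, e1, e2]
  have hFwc : ∀ i : Fin (n + 1), Continuous fun y => Fw y i := by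
    intro i
    simp only [Fw]
    fun_prop
  have hDc : ∀ v : Fin (n + 1) → ℝ × ℝ, Continuous fun y => fderiv ℝ G (π y) v := fun v =>
    ((hG.continuous_fderiv one_ne_zero).comp hπc).clm_apply continuous_const
  -- norms of the unit vectors and the derivative bound on window coordinates
  have hC0 : 0 ≤ C₀ := by
    have h := (norm_nonneg _).trans (hd 0)
    simpa using h
  have hDv : ∀ (y : Fin (n + 2 + 1) → ℝ × ℝ) (v : Fin (n + 1) → ℝ × ℝ), ‖v‖ ≤ 1 →
      |fderiv ℝ G (π y) v| ≤ C₀ * (1 + ‖y‖) ^ m := by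
    intro y v hv
    rw [← Real.norm_eq_abs]
    have h1 : ‖fderiv ℝ G (π y)‖ ≤ C₀ * (1 + ‖y‖) ^ m := by
      refine (hd (π y)).trans ?_
      gcongr
      exact hπn y
    calc ‖fderiv ℝ G (π y) v‖ ≤ ‖fderiv ℝ G (π y)‖ * ‖v‖ := ContinuousLinearMap.le_opNorm _ _
      _ ≤ C₀ * (1 + ‖y‖) ^ m * 1 := mul_le_mul h1 hv (norm_nonneg _) (by positivity)
      _ = C₀ * (1 + ‖y‖) ^ m := mul_one _
  have hv1 : ∀ i : Fin (n + 1), ‖(Pi.single i ((1 : ℝ), (0 : ℝ)) : Fin (n + 1) → ℝ × ℝ)‖ ≤ 1 := by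
    intro i; rw [Pi.norm_single]; simp [Prod.norm_def]
  have hv2 : ∀ i : Fin (n + 1), ‖(Pi.single i ((0 : ℝ), (1 : ℝ)) : Fin (n + 1) → ℝ × ℝ)‖ ≤ 1 := by
    intro i; rw [Pi.norm_single]; simp [Prod.norm_def]
  refine ⟨gL, ?_, ?_, ?_⟩
  · -- continuity
    simp only [gL]
    refine continuous_finsetSum _ fun i _ => ?_
    exact (((continuous_snd.comp (continuous_apply _)).mul (hDc _))).add ((hFwc i).mul (hDc _))
  · -- polynomial bound
    intro y
    set C_F : ℝ := |ω₂| + |lam| + 4 + 8 * |β| with hCF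
    have hCF0 : 0 ≤ C_F := by rw [hCF]; positivity
    set s : ℝ := ‖y‖ with hs
    have hs0 : 0 ≤ s := norm_nonneg _
    have hcoord : ∀ j : Fin (n + 2 + 1), |(y j).1| ≤ s ∧ |(y j).2| ≤ s := fun j =>
      ⟨(norm_fst_le (y j)).trans (norm_le_pi_norm y j), (norm_snd_le (y j)).trans (norm_le_pi_norm y j)⟩
    have hterm : ∀ i : Fin (n + 1),
        |(y (i1 i)).2 * fderiv ℝ G (π y) (Pi.single i (1, 0)) + Fw y i * fderiv ℝ G (π y) (Pi.single i (0, 1))|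
          ≤ (C₀ * (1 + 3 * C_F)) * (1 + s) ^ (m + 3) := by
      intro i
      have hp : |(y (i1 i)).2| ≤ s := (hcoord _).2
      have hF : |Fw y i| ≤ C_F * (1 + 3 * s ^ 3) := by
        have h := abs_forceExpr_le ω₂ lam β ((y (i0 i)).1) ((y (i1 i)).1) ((y (i2 i)).1)
        have ha := pow_le_pow_left₀ (abs_nonneg _) (hcoord (i0 i)).1 3
        have hb := pow_le_pow_left₀ (abs_nonneg _) (hcoord (i1 i)).1 3
        have hc := pow_le_pow_left₀ (abs_nonneg _) (hcoord (i2 i)).1 3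
        refine h.trans (mul_le_mul_of_nonneg_left ?_ hCF0)
        linarith
      have hD1 := hDv y _ (hv1 i)
      have hD2 := hDv y _ (hv2 i)
      have hK0 : 0 ≤ C₀ * (1 + s) ^ m := by positivity
      have h3 : s + C_F * (1 + 3 * s ^ 3) ≤ (1 + 3 * C_F) * (1 + s) ^ 3 := by
        have h1s : s ≤ (1 + s) ^ 3 := by nlinarith [pow_le_pow_left₀ hs0 (by linarith : s ≤ 1 + s) 3]
        have h2s : 1 + 3 * s ^ 3 ≤ 3 * (1 + s) ^ 3 := by nlinarith [pow_le_pow_left₀ hs0 (by linarith : s ≤ 1 + s) 3]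
        nlinarith
      calc |(y (i1 i)).2 * fderiv ℝ G (π y) (Pi.single i (1, 0)) + Fw y i * fderiv ℝ G (π y) (Pi.single i (0, 1))|
          ≤ |(y (i1 i)).2| * |fderiv ℝ G (π y) (Pi.single i (1, 0))| +
              |Fw y i| * |fderiv ℝ G (π y) (Pi.single i (0, 1))| := by
            rw [← abs_mul, ← abs_mul]; exact abs_add_le _ _
        _ ≤ s * (C₀ * (1 + s) ^ m) + C_F * (1 + 3 * s ^ 3) * (C₀ * (1 + s) ^ m) :=
            add_le_add (mul_le_mul hp hD1 (abs_nonneg _) hs0)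
              (mul_le_mul hF hD2 (abs_nonneg _) (by positivity))
        _ = (s + C_F * (1 + 3 * s ^ 3)) * (C₀ * (1 + s) ^ m) := by ring
        _ ≤ (1 + 3 * C_F) * (1 + s) ^ 3 * (C₀ * (1 + s) ^ m) := mul_le_mul_of_nonneg_right h3 hK0
        _ = (C₀ * (1 + 3 * C_F)) * (1 + s) ^ (m + 3) := by ring
    calc |gL y| ≤ ∑ i : Fin (n + 1),
          |(y (i1 i)).2 * fderiv ℝ G (π y) (Pi.single i (1, 0)) + Fw y i * fderiv ℝ G (π y) (Pi.single i (0, 1))| :=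
          Finset.abs_sum_le_sum_abs _ _
      _ ≤ ∑ _i : Fin (n + 1), (C₀ * (1 + 3 * C_F)) * (1 + s) ^ (m + 3) := Finset.sum_le_sum fun i _ => hterm i
      _ = ((n : ℝ) + 1) * (C₀ * (1 + 3 * C_F)) * (1 + s) ^ (m + 3) := by
          rw [Finset.sum_const, Finset.card_univ, Fintype.card_fin, nsmul_eq_mul]; push_cast; ring
  · -- the box formula
    intro a
    funext σ
    have hdiff : DifferentiableAt ℝ G (boxRestrictAt a n σ) := (hG.differentiable one_ne_zero) _
    rw [liouvilleZ_comp_boxRestrictAt _ a n σ hdiff, Function.comp_apply]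
    simp only [gL, hπbox a σ, hFw a σ]
    refine Finset.sum_congr rfl fun i _ => ?_
    simp only [boxRestrictAt_apply, e1]

/-- The bond current `j_x` of the pinned chain as a continuous polynomially bounded window function on the
two-site box `{x, x+1}` (packaging of `bondCurrentZ_pinnedChain_eq_comp_boxRestrictAt`,
`continuous_bondCurrentWindow`, `polyBound_bondCurrentWindow`). -/
theorem exists_bondCurrentWindow (ω₂ lam β γ : ℝ) :
    ∃ jw : (Fin (1 + 1) → ℝ × ℝ) → ℝ, Continuous jw ∧ (∀ y, |jw y| ≤ (2 + 8 * |β|) * (1 + ‖y‖) ^ 4) ∧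
      ∀ x : ℤ, jw ∘ boxRestrictAt x 1 = fun σ => (pinnedChain ω₂ lam β γ).bondCurrentZ σ x :=
  ⟨_, continuous_bondCurrentWindow β, polyBound_bondCurrentWindow β,
    fun x => (bondCurrentZ_pinnedChain_eq_comp_boxRestrictAt ω₂ lam β γ x).symm⟩

/-- **Transport to a bigger box.** A continuous polynomially bounded window function on a box
`{a', …, a'+n'} ⊆ {A₀, …, A₀+K}` is a continuous window function on the big box with the SAME polynomial
bound. -/
theorem exists_bigWindow {A₀ a' : ℤ} {K n' : ℕ} (h₁ : A₀ ≤ a') (h₂ : a' + n' ≤ A₀ + K)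
    {g : (Fin (n' + 1) → ℝ × ℝ) → ℝ} (hg : Continuous g) {C₀ : ℝ} {m : ℕ} (hC₀ : 0 ≤ C₀)
    (hb : ∀ y, |g y| ≤ C₀ * (1 + ‖y‖) ^ m) :
    ∃ w : (Fin (K + 1) → ℝ × ℝ) → ℝ, Continuous w ∧ (∀ y, |w y| ≤ C₀ * (1 + ‖y‖) ^ m) ∧
      w ∘ boxRestrictAt A₀ K = g ∘ boxRestrictAt a' n' := by
  obtain ⟨π, hπc, hπn, hπbox⟩ := exists_subwindow_proj h₁ h₂
  refine ⟨fun y => g (π y), hg.comp hπc, fun y => (hb (π y)).trans ?_, ?_⟩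
  · exact mul_le_mul_of_nonneg_left (pow_le_pow_left₀ (by positivity) (by linarith [hπn y]) m) hC₀
  · funext σ
    simp only [Function.comp_apply, hπbox]

/-- Weakening a polynomial bound (larger constant, larger degree). -/
theorem polyBound_weaken {C C' : ℝ} {k k' : ℕ} (hC : 0 ≤ C) (hCC : C ≤ C') (hk : k ≤ k') {t v : ℝ}
    (ht : 0 ≤ t) (h : |v| ≤ C * (1 + t) ^ k) : |v| ≤ C' * (1 + t) ^ k' :=
  h.trans (mul_le_mul hCC (pow_le_pow_right₀ (by linarith) hk) (by positivity) (hC.trans hCC))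

/-! ## Linearity on one box: three terms and block sums -/

/-- Three-term linearity on one box, from the two-term linearity hypothesis (1) of the stub. -/
theorem apply_lin3_comp_boxRestrictAt (Λ : (ChainConfig → ℝ) → ℝ)
    (hlin : ∀ (a : ℤ) (n : ℕ) (c₁ c₂ : ℝ) (g₁ g₂ : (Fin (n + 1) → ℝ × ℝ) → ℝ), Continuous g₁ →
      Continuous g₂ →
      (∃ (C₀ : ℝ) (m : ℕ), ∀ y, |g₁ y| ≤ C₀ * (1 + ‖y‖) ^ m ∧ |g₂ y| ≤ C₀ * (1 + ‖y‖) ^ m) →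
      Λ ((fun y => c₁ * g₁ y + c₂ * g₂ y) ∘ boxRestrictAt a n) =
        c₁ * Λ (g₁ ∘ boxRestrictAt a n) + c₂ * Λ (g₂ ∘ boxRestrictAt a n))
    (a : ℤ) (n : ℕ) (c₁ c₂ c₃ : ℝ) {g₁ g₂ g₃ : (Fin (n + 1) → ℝ × ℝ) → ℝ} (h₁ : Continuous g₁)
    (h₂ : Continuous g₂) (h₃ : Continuous g₃) {C₀ : ℝ} {m : ℕ} (hC₀ : 0 ≤ C₀)
    (hb₁ : ∀ y, |g₁ y| ≤ C₀ * (1 + ‖y‖) ^ m) (hb₂ : ∀ y, |g₂ y| ≤ C₀ * (1 + ‖y‖) ^ m)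
    (hb₃ : ∀ y, |g₃ y| ≤ C₀ * (1 + ‖y‖) ^ m) :
    Λ ((fun y => c₁ * g₁ y + c₂ * g₂ y + c₃ * g₃ y) ∘ boxRestrictAt a n) =
      c₁ * Λ (g₁ ∘ boxRestrictAt a n) + c₂ * Λ (g₂ ∘ boxRestrictAt a n) +
        c₃ * Λ (g₃ ∘ boxRestrictAt a n) := by
  have h12 := hlin a n c₁ c₂ g₁ g₂ h₁ h₂ ⟨C₀, m, fun y => ⟨hb₁ y, hb₂ y⟩⟩
  have hK : ∀ y : Fin (n + 1) → ℝ × ℝ, 0 ≤ C₀ * (1 + ‖y‖) ^ m := fun y => by positivity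
  have hb12 : ∀ y, |c₁ * g₁ y + c₂ * g₂ y| ≤ (|c₁| + |c₂| + 1) * C₀ * (1 + ‖y‖) ^ m := by
    intro y
    calc |c₁ * g₁ y + c₂ * g₂ y| ≤ |c₁ * g₁ y| + |c₂ * g₂ y| := abs_add_le _ _
      _ = |c₁| * |g₁ y| + |c₂| * |g₂ y| := by rw [abs_mul, abs_mul]
      _ ≤ |c₁| * (C₀ * (1 + ‖y‖) ^ m) + |c₂| * (C₀ * (1 + ‖y‖) ^ m) :=
          add_le_add (mul_le_mul_of_nonneg_left (hb₁ y) (abs_nonneg _))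
            (mul_le_mul_of_nonneg_left (hb₂ y) (abs_nonneg _))
      _ ≤ (|c₁| + |c₂| + 1) * C₀ * (1 + ‖y‖) ^ m := by nlinarith [hK y]
  have hb3' : ∀ y, |g₃ y| ≤ (|c₁| + |c₂| + 1) * C₀ * (1 + ‖y‖) ^ m := by
    intro y
    refine (hb₃ y).trans ?_
    nlinarith [hK y, abs_nonneg c₁, abs_nonneg c₂]
  have h := hlin a n 1 c₃ (fun y => c₁ * g₁ y + c₂ * g₂ y) g₃
    ((continuous_const.mul h₁).add (continuous_const.mul h₂)) h₃
    ⟨(|c₁| + |c₂| + 1) * C₀, m, fun y => ⟨hb12 y, hb3' y⟩⟩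
  have hfun : (fun y => c₁ * g₁ y + c₂ * g₂ y + c₃ * g₃ y) =
      fun y => (1 : ℝ) * (c₁ * g₁ y + c₂ * g₂ y) + c₃ * g₃ y := by
    funext y; ring
  rw [hfun, h, one_mul, h12]

/-- **Block windows.** For finite families `J, L, Ew` of continuous, uniformly polynomially bounded window
functions on one box with `Λ(J_i ∘ box) = 1` and `Λ(L_i ∘ box) = 0`, the block window
`F = Σ_i (c₁ J_i + c₂ L_i + c₃ Ew_i)` is continuous, polynomially bounded, and
`Λ(F ∘ box) = Σ_i (c₁ + c₃ Λ(Ew_i ∘ box))` (`apply_sum_comp_boxRestrictAt` + three-term linearity). -/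
theorem blockWindow_spec (Λ : (ChainConfig → ℝ) → ℝ)
    (hlin : ∀ (a : ℤ) (n : ℕ) (c₁ c₂ : ℝ) (g₁ g₂ : (Fin (n + 1) → ℝ × ℝ) → ℝ), Continuous g₁ →
      Continuous g₂ →
      (∃ (C₀ : ℝ) (m : ℕ), ∀ y, |g₁ y| ≤ C₀ * (1 + ‖y‖) ^ m ∧ |g₂ y| ≤ C₀ * (1 + ‖y‖) ^ m) →
      Λ ((fun y => c₁ * g₁ y + c₂ * g₂ y) ∘ boxRestrictAt a n) =
        c₁ * Λ (g₁ ∘ boxRestrictAt a n) + c₂ * Λ (g₂ ∘ boxRestrictAt a n))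
    (A₀ : ℤ) (K : ℕ) {ι : Type*} [Fintype ι] (c₁ c₂ c₃ : ℝ) (J L Ew : ι → (Fin (K + 1) → ℝ × ℝ) → ℝ)
    (F : (Fin (K + 1) → ℝ × ℝ) → ℝ) (hF : ∀ y, F y = ∑ i, (c₁ * J i y + c₂ * L i y + c₃ * Ew i y))
    (hJc : ∀ i, Continuous (J i)) (hLc : ∀ i, Continuous (L i)) (hEc : ∀ i, Continuous (Ew i))
    {C₀ : ℝ} {m : ℕ} (hC₀ : 0 ≤ C₀) (hJb : ∀ i y, |J i y| ≤ C₀ * (1 + ‖y‖) ^ m)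
    (hLb : ∀ i y, |L i y| ≤ C₀ * (1 + ‖y‖) ^ m) (hEb : ∀ i y, |Ew i y| ≤ C₀ * (1 + ‖y‖) ^ m)
    (hJv : ∀ i, Λ (J i ∘ boxRestrictAt A₀ K) = 1) (hLv : ∀ i, Λ (L i ∘ boxRestrictAt A₀ K) = 0) :
    Continuous F ∧
      (∀ y, |F y| ≤ (Fintype.card ι * ((|c₁| + |c₂| + |c₃|) * C₀)) * (1 + ‖y‖) ^ m) ∧
      Λ (F ∘ boxRestrictAt A₀ K) = ∑ i, (c₁ + c₃ * Λ (Ew i ∘ boxRestrictAt A₀ K)) := by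
  obtain rfl : F = fun y => ∑ i, (c₁ * J i y + c₂ * L i y + c₃ * Ew i y) := funext hF
  have hw : ∀ i, Continuous fun y => c₁ * J i y + c₂ * L i y + c₃ * Ew i y := fun i =>
    ((continuous_const.mul (hJc i)).add (continuous_const.mul (hLc i))).add
      (continuous_const.mul (hEc i))
  have hb : ∀ i y, |c₁ * J i y + c₂ * L i y + c₃ * Ew i y| ≤
      ((|c₁| + |c₂| + |c₃|) * C₀) * (1 + ‖y‖) ^ m := by
    intro i y
    calc |c₁ * J i y + c₂ * L i y + c₃ * Ew i y| ≤ |c₁ * J i y| + |c₂ * L i y| + |c₃ * Ew i y| :=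
          abs_add_three _ _ _
      _ = |c₁| * |J i y| + |c₂| * |L i y| + |c₃| * |Ew i y| := by rw [abs_mul, abs_mul, abs_mul]
      _ ≤ |c₁| * (C₀ * (1 + ‖y‖) ^ m) + |c₂| * (C₀ * (1 + ‖y‖) ^ m) + |c₃| * (C₀ * (1 + ‖y‖) ^ m) :=
          add_le_add (add_le_add (mul_le_mul_of_nonneg_left (hJb i y) (abs_nonneg _))
            (mul_le_mul_of_nonneg_left (hLb i y) (abs_nonneg _)))
            (mul_le_mul_of_nonneg_left (hEb i y) (abs_nonneg _))
      _ = ((|c₁| + |c₂| + |c₃|) * C₀) * (1 + ‖y‖) ^ m := by ring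
  refine ⟨continuous_finsetSum _ fun i _ => hw i, fun y => ?_, ?_⟩
  · calc |∑ i, (c₁ * J i y + c₂ * L i y + c₃ * Ew i y)|
          ≤ ∑ i, |c₁ * J i y + c₂ * L i y + c₃ * Ew i y| := Finset.abs_sum_le_sum_abs _ _
      _ ≤ ∑ _i : ι, ((|c₁| + |c₂| + |c₃|) * C₀) * (1 + ‖y‖) ^ m := Finset.sum_le_sum fun i _ => hb i y
      _ = (Fintype.card ι * ((|c₁| + |c₂| + |c₃|) * C₀)) * (1 + ‖y‖) ^ m := by
          rw [Finset.sum_const, Finset.card_univ, nsmul_eq_mul]; ring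
  · rw [apply_sum_comp_boxRestrictAt Λ hlin A₀ K Finset.univ
      (fun i y => c₁ * J i y + c₂ * L i y + c₃ * Ew i y) hw (by positivity) hb]
    refine Finset.sum_congr rfl fun i _ => ?_
    show Λ ((fun y => c₁ * J i y + c₂ * L i y + c₃ * Ew i y) ∘ boxRestrictAt A₀ K) = _
    rw [apply_lin3_comp_boxRestrictAt Λ hlin A₀ K c₁ c₂ c₃ (hJc i) (hLc i) (hEc i) hC₀ (hJb i) (hLb i)
      (hEb i), hJv i, hLv i]
    ring

end Summit.AtomisticToContinuum.FouriersLaw.Theorems.LocalOhmBirth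

end
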